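import Summits.QuantumFields.BalabanUV.T4Continuum.Support.NE9CurChartUniformBall
import Literature.MathematicalPhysics.QuantumFieldTheory.Balaban1983to89.B11Eq174ChartContinuityAtFlat
import Literature.MathematicalPhysics.QuantumFieldTheory.Balaban1983to89.B11Eq44COperatorModulus

/-!
# NE9CurChartLipschitzAtFlat — THE CHART OF THE CURVE SPECIES `cur U` IS LIPSCHITZ IN THE BACKGROUND AT THE FLAT POINT, AT A FIXED LATTICE:
# for every unit-bounded small-bond background `U` (`‖U(b) − 1‖ ≤ ε`) the chart (174)∘(47) of `cur U`, read into the flat (115) norm, is within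
# `K·(ε + δ_W)` of the chart of `cur 1` on one ball of block fields — every scalar letter AND the Sect. C letter's background modulus PRODUCED; displayed only
# the background modulus `δ_W` of the (L3) slot; cell `pub-balaban`, T4-DAG §2 node U3 / §6 NE9, WALL-NE9-P1 §3 (ii); BINDER row NE9 OWNER lineage
# `b2b-balaban-t4-ne9-p1`, generation 82; Summits-side NEW leaf under the owner's INTERFACE REQUEST NE9 of this generation (ruling e34b3e0c (0): «no new
# leaves unless a CRUX prover requests a specific NAMED interface» — requested: `NE9CurChartLipschitzAtFlat.cur_chart_lipschitz_at_flat_of_small_bonds`;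
# a separate file because the host leaf `NE9CurChartUniformBall` would exceed the 400-line rule), nothing printed asserted

HONEST FRAMING (T4-DAG PAGE 1).  Rung (B)+1 of the FINITE-VOLUME T⁴ programme — NOT infinite volume, NOT a mass gap, NOT the Clay problem.  NE9
(`T4OutputRate.NE9` ∧ `FadingMemory`) is a cell NEW ESTIMATE, NOT PRINTED in [I] = [Balaban1987RG1] (CMP **109**), [II] = [Balaban1988RG2Cluster]
(CMP **116**), and NOT PROVED here («NE9 ⇐ the named binders»; spine PROVED 0∕9).  HONEST DEPENDENCY (cell line, verbatim): continuum YM on T⁴ ⇐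
BetaPertH ∧ nine spine estimates (0/9 proved); BetaPertH ⇐ (D1) ∧ (D4) ∧ CAP+tail; G-an2-4 gates asym, D1 and NE2/3/4.  The `cur U` OBJECT is ONE
item of the MODEL O-NE9-1 (species (a) data); the END's `act` / `ker` halves and NEEDS-COORDINATOR #5 are untouched.

WHAT THIS FILE PROVES (TWO theorems; 0 def, 0 sorry, axioms standard).  **`cur_chart_lipschitz_at_flat_of_small_bonds`**: there are `ε₃ > 0`
(`≤ ε_reg(d, L) = 1∕(256(d+1)²L^{d+1})`), auxiliary radii `ε₄, ε_C`, a constant `K > 0` and radii `r, r_C, R_b > 0` (finite-lattice numbers depending on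
`L, m, η, c₀, c₁, a`, the level weights, `M_φ, M_φ′, C_τ` and the FIXED quadratic-analyticity constants `(C₄, a₃)` of the (L3) slot) such that for EVERY
background `U` with `U(b) ∈ U1`, `‖U(b) − 1‖ ≤ ε ≤ ε₃` and `hRS`, every pair of (L3) slots `W_U : Space115(∇_U) → |·|_(−3)`, `W_1 : Space115(∇_1) → |·|_(−3)`
with `QuadAnalytic · C₄ a₃` and a background modulus `‖W_U P − W_1(ιP)‖ ≤ δ_W` on `‖P‖ < r`, and every block field `B ∈ ball 0 R_b`: the positivity `hpos` at
`U` and at `1` HOLD and `‖ι(chart_U B) − chart_1 B‖_(115),∇_1 ≤ K·(ε + δ_W)`, where `chart_U = chartHB 𝔊(U) 0 W_U 0 (A′ ↦ A′ + solA H₁(U) 0 C(U) 0 ε_C A′) ε₄ H₁(U)` is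
the species' chart of `NE9CurChartUniformBall.cur_chart_exists_of_small_bonds` (the same letters; auxiliary radii immaterial by
`B11Eq174Chart.Regime.chartH_eq_of_le`) and `ι` the jet identity `∇_U → ∇_1`.  MECHANISM: `B11Eq174ChartContinuityAtFlat.exists_chartHB_lipschitz_at_flat`
(the letter defects `K_ι, δ_G, δ_A` PRODUCED from [Balaban1985BackgroundPropagators] Thm 3.4's fixed-lattice reading `B9Eq386LipschitzH1` /
`B9Eq3153FrakGLipschitz` through [Balaban1985Variational] (117)'s norm comparisons) with ALL FOUR regimes and the radius bookkeeping PRODUCED: the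
uniform bounds of `H₁(U)`, `𝔊(U)` (`B9Eq3126H1BoundCLM`, also at `U = 1`), `C(U)`'s U-free constants (`quadAnalytic_Cc`) and ITS BACKGROUND MODULUS at the flat
point (`B11Eq44COperatorModulus.exists_Cc_modulus_at_flat` ⇐ `B7Eq123BackgroundModulus`: [Balaban1985Averaging] Prop. 7's analyticity in the background read as a
Lipschitz modulus by a Cauchy estimate), the scalar letters WITH ROOM under a cap (`B11Eq118RegimeScalars.exists_twoRegimes_radii_of_bounds_room_cap`: radii at
`(3C₄, a₃∕3)`, Sect. C ball inside the modulus' radius), E162's structural binders from the bond smallness (`B9Eq335SmallBondsData`), `hpos` by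
`B9Thm311SmallFieldClosed` / `B5Eq172FlatCoercivity.laplaceAofBackground_one_pos₀`.  **`cur_chart_lipschitz_at_flat_of_small_bonds_unitary`**: the same with
`hRS` discharged by `hRS_of_unitary` (unitary bond variables, tracial `τ`, `⟨φ⁻¹X, φ⁻¹Y⟩ = τ(X⋆Y)`) — binders {`U(b) ∈ U1`, `‖U(b) − 1‖ ≤ ε`, unitary} only.
DISGUISE TEST: composition of landed theorems; no inequality of the series proved; the constant `K` is a finite-lattice number — NOT print's uniformity
in the LATTICE ([Balaban1985BackgroundPropagators] Thms 3.12/3.13), NOT analyticity in the background ([Balaban1985BackgroundPropagators] Thm 3.4 proper),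
NOT the (L3) `W` itself nor its modulus `δ_W` (NE9 leaf-05's `W80`); not NE9.
References (TYPES ∕ loci only): [Balaban1985Variational] (45)–(47) p. 285, Prop. 6 (117)–(121) p. 295, (172)–(175) p. 305, Prop. 9 p. 309;
[Balaban1985BackgroundPropagators] (3.3) p. 391, Thm 3.4 p. 400, Thm 3.11 p. 416, (3.126) p. 420, (3.153) p. 426; [Balaban1985Averaging] Prop. 7 p. 43.
Imports `Support/NE9CurChartUniformBall` (v1.2), `B11Eq174ChartContinuityAtFlat`, `B11Eq44COperatorModulus`; modifies nothing; no END re-wired.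
Value = WALL-NE9-P1 §3 (ii) «the chart of `cur U` at the constructed letters»: its dependence on the background is now a KERNEL Lipschitz statement at
the flat point modulo ONE displayed modulus (δ_W); NOT summit progress.
-/

noncomputable section

open Metric Set

namespace Summit.QuantumFields.BalabanUV.T4Continuum.NE9CurChartLipschitzAtFlat

open Literature.MathematicalPhysics.QuantumFieldTheory.Balaban1983to89
open B11Eq103H1Complex B11Eq115Space B11Eq174Chart B11Eq111FrakG
open B13Contraction113 (QuadAnalytic)
open B9Eq319QprimeTorus (fineP)
open B9SectCLatticeCarrier (Bond)
open B4Sect5Torus (TSite)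
open B7Prop1Explicit (U1 Wcx boxVec)
open B9Eq315QTorus (perCfg cornerSite QtorusW laplaceAofBackground)
open B9Eq315QTorusOnto (QtorusW_surjective)
open B9Eq310HessianOperator (adTransportW hessOp)
open B11Eq44COperatorTorus (Cc quadAnalytic_Cc)
open B5Eq172FlatCoercivity (hU1_one hreg_one laplaceAofBackground_one_pos₀)
open B9Eq384RemainderLetters (hRS_one)
open B9Thm311SmallFieldClosed (laplaceAofBackground_pos_of_small_field hRS_of_unitary)
open B9Eq3126H1BoundCLM (exists_H1_frakG_CLM_bound_of_small_field)
open B11Eq118RegimeScalars (exists_twoRegimes_radii_of_bounds_room_cap)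
open B11Eq44COperatorModulus (exists_Cc_modulus_at_flat)
open B9Eq335SmallBondsData (perCfg_mem_U1 hreg_of_small_bonds alpha_le_128 alpha_le_64 alphaL_le_half epsReg_pos)
open B11Eq174ChartContinuityAtFlat (exists_chartHB_lipschitz_at_flat)

set_option maxHeartbeats 1600000 in
set_option maxRecDepth 8192 in
/-- **THE CHART OF THE CURVE SPECIES IS LIPSCHITZ IN THE BACKGROUND AT THE FLAT POINT, ON ONE BALL, FOR EVERY UNIT-BOUNDED SMALL-BOND BACKGROUND
OF A FIXED LATTICE** — see the module header: `‖ι(chart_U B) − chart_1 B‖_(115),∇_1 ≤ K·(ε + δ_W)` for `‖U(b) − 1‖ ≤ ε ≤ ε₃`, `B ∈ ball 0 R_b`,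
(L3) slots with `QuadAnalytic · C₄ a₃` and modulus `δ_W` on `‖P‖ < r`; every scalar letter, all four regimes at `U` and at `1`, the `C(U)`-letter's background
modulus, the positivity `hpos`, `Q onto`, and E162's structural binders PRODUCED.  NOT print's uniformity in the lattice; NOT the modulus `δ_W` itself. [folklore] -/
theorem cur_chart_lipschitz_at_flat_of_small_bonds {d : ℕ} (L : ℕ) [NeZero L] (m : Fin d → ℕ) [∀ i, NeZero (fineP L m i)] (hL : 1 ≤ L)
    {𝔸 : Type*} [NormedRing 𝔸] [NormedAlgebra ℂ 𝔸] [CompleteSpace 𝔸] [NormOneClass 𝔸] [StarRing 𝔸] [NormedStarGroup 𝔸] [StarModule ℂ 𝔸]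
    [FiniteDimensional ℂ 𝔸]
    {W : Type*} [NormedAddCommGroup W] [InnerProductSpace ℂ W] [FiniteDimensional ℂ W] (φ : W ≃ₗ[ℂ] 𝔸) {Mφ Mφ' : ℝ} (hMφ : 0 ≤ Mφ)
    (hMφ' : 0 ≤ Mφ') (hφ : ∀ w, ‖φ w‖ ≤ Mφ * ‖w‖) (hφ' : ∀ X, ‖φ.symm X‖ ≤ Mφ' * ‖X‖)
    (τ : 𝔸 →ₗ[ℂ] ℂ) {Cτ : ℝ} (hτ : ∀ X, ‖τ X‖ ≤ Cτ * ‖X‖) (hCτ : 0 ≤ Cτ)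
    {η : ℝ} [Fact (0 < (L : ℝ))] [Fact (0 < η)] {lev₀ : Bond d (fineP L m) → ℕ} {levB : Bond d m → ℕ} (lev₁ : Bond d (fineP L m) × Fin d → ℕ)
    (hlev : ∀ b, 1 ≤ lev₀ b) {c₀ c₁ : ℝ} [Fact (0 < c₀)] [Fact (0 < c₁)] {a : ℝ} (ha : 0 < a) {C₄ a₃ : ℝ} (hC₄ : 0 ≤ C₄) (ha₃ : 0 < a₃) :
    ∃ ε₃ ε₄ εC K r Rb : ℝ, 0 < ε₃ ∧ ε₃ ≤ 1 / (256 * ((d : ℝ) + 1) ^ 2 * (L : ℝ) ^ (d + 1)) ∧ 0 < K ∧ 0 < r ∧ 0 < Rb ∧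
      ∀ (U : Bond d (fineP L m) → 𝔸ˣ) (hU : ∀ b, U b ∈ U1 𝔸) {ε : ℝ} (hε : 0 ≤ ε)
      (hεr : ε ≤ 1 / (256 * ((d : ℝ) + 1) ^ 2 * (L : ℝ) ^ (d + 1))), ε ≤ ε₃ → ∀ (hUε : ∀ b, ‖(U b : 𝔸) - 1‖ ≤ ε),
      (∀ (b : Bond d (fineP L m)) (v u : W), inner ℂ (adTransportW φ U b v) u = inner ℂ v (adTransportW φ (fun b => (U b)⁻¹) b u)) →
      ∀ {W₁ : Space115 (L : ℝ) η lev₀ lev₁ (nabla115 η U) → NegSize (L : ℝ) η lev₀ 3 𝔸}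
        {W₂ : Space115 (L : ℝ) η lev₀ lev₁ (nabla115 η fun _ : Bond d (fineP L m) => (1 : 𝔸ˣ)) → NegSize (L : ℝ) η lev₀ 3 𝔸},
        QuadAnalytic W₁ C₄ a₃ → QuadAnalytic W₂ C₄ a₃ →
      ∀ {δW : ℝ}, 0 ≤ δW →
        (∀ P : Space115 (L : ℝ) η lev₀ lev₁ (nabla115 η U), ‖P‖ < r →
          ‖W₁ P - W₂ (LinearMap.toContinuousLinearMap
            ((jetLinearEquiv (L : ℝ) η lev₀ lev₁ (nabla115 η (fun _ : Bond d (fineP L m) => (1 : 𝔸ˣ)))).symm.toLinearMap ∘ₗ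
              (jetLinearEquiv (L : ℝ) η lev₀ lev₁ (nabla115 η U)).toLinearMap) P)‖ ≤ δW) →
      ∀ B ∈ ball (0 : NegSize (L : ℝ) η levB 0 𝔸) Rb,
      ∃ (hpos : ∀ x : BondL2K ℂ d (fineP L m) c₀ W, x ≠ 0 →
          0 < RCLike.re (inner ℂ x (laplaceAofBackground L m hL φ U (alpha_le_64 hL hε hεr) (perCfg_mem_U1 L m hU)
            (hreg_of_small_bonds L m hU hε hUε) τ η (c₀ := c₀) (c₁ := c₁) a x)))
        (hpos₁ : ∀ x : BondL2K ℂ d (fineP L m) c₀ W, x ≠ 0 →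
          0 < RCLike.re (inner ℂ x (laplaceAofBackground L m hL φ (fun _ => 1) (show (0 : ℝ) ≤ 1 / 64 by norm_num) (hU1_one L m) (hreg_one L m)
            τ η (c₀ := c₀) (c₁ := c₁) a x))),
      ‖LinearMap.toContinuousLinearMap
            ((jetLinearEquiv (L : ℝ) η lev₀ lev₁ (nabla115 η (fun _ : Bond d (fineP L m) => (1 : 𝔸ˣ)))).symm.toLinearMap ∘ₗ
              (jetLinearEquiv (L : ℝ) η lev₀ lev₁ (nabla115 η U)).toLinearMap)
          (chartHB (frakGLatticeCLM (lev₀ := lev₀) φ hpos (QtorusW_surjective L m hL U (alpha_le_64 hL hε hεr) (perCfg_mem_U1 L m hU)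
              (hreg_of_small_bonds L m hU hε hUε) (alphaL_le_half hL hεr) φ) lev₁ (nabla115 η U)) 0 W₁ 0
            (fun A' => A' + solA (H1LatticeCLM (lev₀ := lev₀) (levB := levB) φ hpos (QtorusW_surjective L m hL U (alpha_le_64 hL hε hεr)
              (perCfg_mem_U1 L m hU) (hreg_of_small_bonds L m hU hε hUε) (alphaL_le_half hL hεr) φ) lev₁ (nabla115 η U)) 0
              (Cc L m η U lev₀ lev₁ (nabla115 η U) levB) 0 εC A') ε₄
            (H1LatticeCLM (lev₀ := lev₀) (levB := levB) φ hpos (QtorusW_surjective L m hL U (alpha_le_64 hL hε hεr) (perCfg_mem_U1 L m hU)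
              (hreg_of_small_bonds L m hU hε hUε) (alphaL_le_half hL hεr) φ) lev₁ (nabla115 η U)) B) -
        chartHB (frakGLatticeCLM (lev₀ := lev₀) (Δ₁ := hessOp φ η (fun _ => 1) τ)
              (Q := QtorusW L m hL φ (fun _ => 1) (show (0 : ℝ) ≤ 1 / 64 by norm_num) (hU1_one L m) (hreg_one L m) (c₀ := c₀) (c₁ := c₁))
              φ hpos₁ (QtorusW_surjective L m hL (fun _ => 1) (show (0 : ℝ) ≤ 1 / 64 by norm_num) (hU1_one L m) (hreg_one L m)
                (show 50 * ((d : ℝ) + 1) * (0 : ℝ) * (L : ℝ) ^ d ≤ 1 / 2 by norm_num) φ) lev₁ (nabla115 η fun _ => 1)) 0 W₂ 0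
          (fun A' => A' + solA (H1LatticeCLM (lev₀ := lev₀) (levB := levB) (Δ₁ := hessOp φ η (fun _ => 1) τ)
              (Q := QtorusW L m hL φ (fun _ => 1) (show (0 : ℝ) ≤ 1 / 64 by norm_num) (hU1_one L m) (hreg_one L m) (c₀ := c₀) (c₁ := c₁))
              φ hpos₁ (QtorusW_surjective L m hL (fun _ => 1) (show (0 : ℝ) ≤ 1 / 64 by norm_num) (hU1_one L m) (hreg_one L m)
                (show 50 * ((d : ℝ) + 1) * (0 : ℝ) * (L : ℝ) ^ d ≤ 1 / 2 by norm_num) φ) lev₁ (nabla115 η fun _ => 1)) 0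
            (Cc L m η (fun _ : Bond d (fineP L m) => (1 : 𝔸ˣ)) lev₀ lev₁ (nabla115 η fun _ => 1) levB) 0 εC A') ε₄
          (H1LatticeCLM (lev₀ := lev₀) (levB := levB) (Δ₁ := hessOp φ η (fun _ => 1) τ)
            (Q := QtorusW L m hL φ (fun _ => 1) (show (0 : ℝ) ≤ 1 / 64 by norm_num) (hU1_one L m) (hreg_one L m) (c₀ := c₀) (c₁ := c₁))
            φ hpos₁ (QtorusW_surjective L m hL (fun _ => 1) (show (0 : ℝ) ≤ 1 / 64 by norm_num) (hU1_one L m) (hreg_one L m)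
              (show 50 * ((d : ℝ) + 1) * (0 : ℝ) * (L : ℝ) ^ d ≤ 1 / 2 by norm_num) φ) lev₁ (nabla115 η fun _ => 1)) B‖ ≤
        K * (ε + δW) := by
  have hη : η ≠ 0 := ne_of_gt (Fact.out : 0 < η)
  -- (1) the chart-level composition with its PRODUCED letter defects (gen 82)
  obtain ⟨KG, KA, Kι, ε₉, hKG, hKA, hKι, hε₉, HL⟩ :=
    exists_chartHB_lipschitz_at_flat L m hL φ (c₀ := c₀) (c₁ := c₁) (η := η) lev₀ levB lev₁ ha hMφ hMφ' hφ hφ' τ hτ hCτ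
  -- (2) Thm 3.11 at every small field (gen 80)
  obtain ⟨ε₃', hε₃', Hpos⟩ := laplaceAofBackground_pos_of_small_field L m hL φ (c₀ := c₀) (c₁ := c₁) hη ha hMφ hMφ' hφ hφ' τ hτ hCτ
  -- (3) the uniform bounds of `H₁(U)`, `𝔊(U)` in the chart's type (gen 81)
  obtain ⟨CH, CG, ε₅, hCH, hCG, hε₅, Hb⟩ :=
    exists_H1_frakG_CLM_bound_of_small_field L m hL φ (c₀ := c₀) (c₁ := c₁) (η := η) lev₀ levB lev₁ ha hMφ hMφ' hφ hφ' τ hτ hCτ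
  -- (3b) the background modulus of the Sect. C letter `C(U)` on a ball (gen 82)
  obtain ⟨KC, rCm, hKC, hrCm, HC⟩ := exists_Cc_modulus_at_flat L m (η := η) lev₀ lev₁ levB hL (𝔸 := 𝔸)
  -- (4) the scalar letters with room, the Sect. C ball capped inside that radius (gen 82)
  obtain ⟨j, a', ε₄, aC, εC, Rb, hj, ha', hε₄, haC, hεC, hRb0, hcap, hcapC, ⟨hdom6, hcontr12, hCdom6, hCcontr12⟩, Hreg⟩ :=
    exists_twoRegimes_radii_of_bounds_room_cap (B₀ := CG) (b := CH) (b₁ := CH) (C₄ := C₄) (a₃ := a₃) (C₂ := 2097152 * ((d : ℝ) + 1) ^ 2)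
      (c₄ := 1 / (512 * ((d : ℝ) + 1))) hCG.le hCH.le hCH.le hC₄ ha₃ (by positivity) (by positivity) (half_pos hrCm)
  -- the two denominators and the constant
  obtain ⟨D₂, hD₂def⟩ : ∃ D₂ : ℝ, D₂ = 1 - 12 * CG * C₄ * (ε₄ + a') := ⟨_, rfl⟩
  obtain ⟨DC, hDCdef⟩ : ∃ DC : ℝ, DC = 1 - 12 * CH * (2097152 * ((d : ℝ) + 1) ^ 2) * (εC + aC) := ⟨_, rfl⟩
  have hD₂ : 0 < D₂ := by rw [hD₂def]; linarith only [hcontr12]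
  have hDC : 0 < DC := by rw [hDCdef]; linarith only [hCcontr12]
  have hD₂1 : D₂ ≤ 1 := by
    rw [hD₂def]; have : 0 ≤ 12 * CG * C₄ * (ε₄ + a') := by positivity
    linarith only [this]
  obtain ⟨Kn, hKndef⟩ : ∃ Kn : ℝ, Kn = KG * (j + C₄ * (ε₄ + a') ^ 2) + KA * Rb + KA * (2097152 * ((d : ℝ) + 1) ^ 2 * (εC + aC) ^ 2) +
      CG + CH + 1 := ⟨_, rfl⟩
  have hKn : 0 < Kn := by rw [hKndef]; positivity
  refine ⟨min (min (min ε₃' ε₅) (min ε₉ (min (1 / Kι) (1 / (256 * ((d : ℝ) + 1) ^ 2 * (L : ℝ) ^ (d + 1)))))) (1 / (12288 * ((2 * (d * L) + L + L : ℕ) : ℝ))),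
    ε₄, εC, Kn / (DC * D₂) * (1 + KC * rCm), ε₄ + a', Rb,
    lt_min (lt_min (lt_min hε₃' hε₅) (lt_min hε₉ (lt_min (by positivity) (epsReg_pos hL)))) (by positivity),
    (min_le_left _ _).trans ((min_le_right _ _).trans ((min_le_right _ _).trans (min_le_right _ _))), by positivity, by positivity, hRb0, ?_⟩
  intro U hU ε hε hεr hεm hUε hRS W₁ W₂ hW₁ hW₂ δW hδW0 hδW B hB
  have hεN : ε ≤ 1 / (12288 * ((2 * (d * L) + L + L : ℕ) : ℝ)) := hεm.trans (min_le_right _ _)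
  have hεm' := hεm.trans (min_le_left _ _)
  have hεε₃' : ε ≤ ε₃' := hεm'.trans ((min_le_left _ _).trans (min_le_left _ _))
  have hεε₅ : ε ≤ ε₅ := hεm'.trans ((min_le_left _ _).trans (min_le_right _ _))
  have hεε₉ : ε ≤ ε₉ := hεm'.trans ((min_le_right _ _).trans (min_le_left _ _))
  have hεK : ε ≤ 1 / Kι := hεm'.trans ((min_le_right _ _).trans ((min_le_right _ _).trans (min_le_left _ _)))
  -- the C-letter's modulus on the Sect. C ball: `δ_C := K_C·ε·rCm`
  obtain ⟨δC, hδCdef⟩ : ∃ δC : ℝ, δC = KC * ε * rCm := ⟨_, rfl⟩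
  have hδC0 : 0 ≤ δC := by rw [hδCdef]; positivity
  have hδC : ∀ P : Space115 (L : ℝ) η lev₀ lev₁ (nabla115 η U), ‖P‖ < εC + aC →
      ‖Cc L m η U lev₀ lev₁ (nabla115 η U) levB P - Cc L m η (fun _ : Bond d (fineP L m) => (1 : 𝔸ˣ)) lev₀ lev₁ (nabla115 η fun _ => 1) levB
        (LinearMap.toContinuousLinearMap
          ((jetLinearEquiv (L : ℝ) η lev₀ lev₁ (nabla115 η (fun _ : Bond d (fineP L m) => (1 : 𝔸ˣ)))).symm.toLinearMap ∘ₗ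
            (jetLinearEquiv (L : ℝ) η lev₀ lev₁ (nabla115 η U)).toLinearMap) P)‖ ≤ δC := fun P hP => by
    have hPr : ‖P‖ < rCm := by linarith only [hP, hcapC, hrCm]
    refine (HC U hU hε hεN hUε P hPr).trans ?_
    rw [hδCdef]
    exact mul_le_mul_of_nonneg_left hPr.le (by positivity)
  -- E162's structural binders PRODUCED from the bond smallness
  have hα := alpha_le_128 hL hε hεr
  have hα1 := alpha_le_64 hL hε hεr
  have hU1 := perCfg_mem_U1 L m hU
  have hreg := hreg_of_small_bonds L m hU hε hUε
  have hαL := alphaL_le_half hL hεr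
  have hαL0 : 50 * ((d : ℝ) + 1) * (0 : ℝ) * (L : ℝ) ^ d ≤ 1 / 2 := by norm_num
  -- positivity at `U` and at `1`, `Q` onto at both
  have hpos := Hpos U hα1 hU1 hreg hε hεε₃' hUε hRS
  have hRS₁ := hRS_one L m φ (𝔸 := 𝔸)
  have hpos₁ := Hpos (fun _ => 1) (show (0 : ℝ) ≤ 1 / 64 by norm_num) (hU1_one L m) (hreg_one L m) le_rfl hε₃'.le
    (fun b => by simp) hRS₁
  refine ⟨hpos, hpos₁, ?_⟩
  have hQ := QtorusW_surjective L m hL U hα1 hU1 hreg hαL φ (c₀ := c₀) (c₁ := c₁)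
  have hQ₁ := QtorusW_surjective L m hL (fun _ : Bond d (fineP L m) => (1 : 𝔸ˣ)) (show (0 : ℝ) ≤ 1 / 64 by norm_num) (hU1_one L m)
    (hreg_one L m) hαL0 φ (c₀ := c₀) (c₁ := c₁)
  -- the letters' bounds at `U` and at `1`
  obtain ⟨hHU, hGU⟩ := Hb U hα1 hU1 hreg hε hεε₅ hUε hRS hpos hQ
  obtain ⟨hH1, hG1⟩ := Hb (fun _ => 1) (show (0 : ℝ) ≤ 1 / 64 by norm_num) (hU1_one L m) (hreg_one L m) le_rfl hε₅.le
    (fun b => by simp) hRS₁ hpos₁ hQ₁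
  have hGUpt : ∀ f : NegSize (L : ℝ) η lev₀ 3 𝔸,
      ‖frakGLatticeCLM (lev₀ := lev₀) φ hpos hQ lev₁ (nabla115 η U) f‖ ≤ CG * ‖f‖ :=
    fun f => (ContinuousLinearMap.le_opNorm _ f).trans (mul_le_mul_of_nonneg_right hGU (norm_nonneg f))
  have hHUpt : ∀ B : NegSize (L : ℝ) η levB 0 𝔸,
      ‖H1LatticeCLM (lev₀ := lev₀) (levB := levB) φ hpos hQ lev₁ (nabla115 η U) B‖ ≤ CH * ‖B‖ :=
    fun B => (ContinuousLinearMap.le_opNorm _ B).trans (mul_le_mul_of_nonneg_right hHU (norm_nonneg B))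
  have hG1pt : ∀ f : NegSize (L : ℝ) η lev₀ 3 𝔸,
      ‖frakGLatticeCLM (lev₀ := lev₀) φ hpos₁ hQ₁ lev₁ (nabla115 η fun _ => 1) f‖ ≤ CG * ‖f‖ :=
    fun f => (ContinuousLinearMap.le_opNorm _ f).trans (mul_le_mul_of_nonneg_right hG1 (norm_nonneg f))
  have hH1pt : ∀ B : NegSize (L : ℝ) η levB 0 𝔸,
      ‖H1LatticeCLM (lev₀ := lev₀) (levB := levB) φ hpos₁ hQ₁ lev₁ (nabla115 η fun _ => 1) B‖ ≤ CH * ‖B‖ :=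
    fun B => (ContinuousLinearMap.le_opNorm _ B).trans (mul_le_mul_of_nonneg_right hH1 (norm_nonneg B))
  have hCU := quadAnalytic_Cc L m η U lev₀ lev₁ (nabla115 η U) levB hL hα hU1 hreg hlev
  have hC1 := quadAnalytic_Cc L m η (fun _ : Bond d (fineP L m) => (1 : 𝔸ˣ)) lev₀ lev₁ (nabla115 η fun _ => 1) levB hL
    (show (0 : ℝ) ≤ 1 / 128 by norm_num) (hU1_one L m) (hreg_one L m) hlev
  -- the four regimes and the datum letters
  obtain ⟨R₁, RC₁, hBall₁⟩ := Hreg _ W₁ _ _ _ hGUpt hW₁ hHUpt hCU hHUpt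
  obtain ⟨R₂, RC₂, hBall₂⟩ := Hreg _ W₂ _ _ _ hG1pt hW₂ hH1pt hC1 hH1pt
  have hB₁ := hBall₁ B hB
  have hB₂ := hBall₂ B hB
  -- the radius bookkeeping: `ρ := 2(ε₄ + a)`, `s := ε₄ + a` (and the Sect. C twin), `‖ι‖ ≤ 1 + Kι ε ≤ 2`
  have hKιε : Kι * ε ≤ 1 := by
    have h := mul_le_mul_of_nonneg_left hεK hKι.le
    rwa [mul_one_div_cancel hKι.ne'] at h
  have hm : 0 < ε₄ + a' := by linarith only [hε₄, ha']
  have hmC : 0 < εC + aC := by linarith only [hεC, haC]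
  have hρ₁ : (1 + Kι * ε) * (ε₄ + a') ≤ 2 * (ε₄ + a') := by nlinarith only [hKιε, hm]
  have hρC₁ : (1 + Kι * ε) * (εC + aC) ≤ 2 * (εC + aC) := by nlinarith only [hKιε, hmC]
  have hdom : 2 * (2 * (ε₄ + a') + (ε₄ + a')) ≤ a₃ := by linarith only [hdom6]
  have hdomC : 2 * (2 * (εC + aC) + (εC + aC)) ≤ 1 / (512 * ((d : ℝ) + 1)) := by linarith only [hCdom6]
  have hκ : 0 + 4 * CG * C₄ * (2 * (ε₄ + a') + (ε₄ + a')) < 1 := by linarith only [hcontr12]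
  have hκC : 4 * CH * (2097152 * ((d : ℝ) + 1) ^ 2) * (2 * (εC + aC) + (εC + aC)) < 1 := by linarith only [hCcontr12]
  have hmain := HL U hα1 hU1 hreg hε hεε₉ hUε hRS hpos hQ hpos₁ hQ₁ (W₁ := W₁) (W₂ := W₂) R₁ R₂ hj.le hj.le B hB₁ hB₂ hδW hρ₁
    (by linarith only [hm]) hm hdom hκ RC₁ RC₂ hcap hcap hδC hρC₁ (by linarith only [hmC]) hmC hdomC hκC
  -- it suffices to reach `Kn∕(DC·D₂)·(ε + δ_W + δ_C)` with `δ_C = K_C·ε·rCm ≤ K_C·rCm·(ε + δ_W)`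
  suffices hS : _ ≤ Kn / (DC * D₂) * (ε + δW + δC) by
    refine hS.trans ?_
    have hK0 : 0 ≤ Kn / (DC * D₂) := by positivity
    have h1 : ε + δW + δC ≤ (1 + KC * rCm) * (ε + δW) := by
      rw [hδCdef]; nlinarith [mul_nonneg hKC.le hrCm.le, hδW0, hε]
    calc Kn / (DC * D₂) * (ε + δW + δC) ≤ Kn / (DC * D₂) * ((1 + KC * rCm) * (ε + δW)) := mul_le_mul_of_nonneg_left h1 hK0
      _ = Kn / (DC * D₂) * (1 + KC * rCm) * (ε + δW) := by ring
  refine hmain.trans ?_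
  -- arithmetic: the right-hand side is at most `Kn∕(DC·D₂)·(ε + δ_W + δ_C)`
  have e₂ : 1 - (0 + 4 * CG * C₄ * (2 * (ε₄ + a') + (ε₄ + a'))) = D₂ := by rw [hD₂def]; ring
  have eC : 1 - 4 * CH * (2097152 * ((d : ℝ) + 1) ^ 2) * (2 * (εC + aC) + (εC + aC)) = DC := by rw [hDCdef]; ring
  rw [e₂, eC]
  have hBRb : ‖B‖ ≤ Rb := (mem_ball_zero_iff.1 hB).le
  have hN₂ : KG * ε * (j + C₄ * (ε₄ + a') ^ 2) + 0 * (ε₄ + a') + CG * δW + KA * ε * ‖B‖ ≤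
      (KG * (j + C₄ * (ε₄ + a') ^ 2) + KA * Rb) * ε + CG * δW := by
    have h1 : KA * ε * ‖B‖ ≤ KA * ε * Rb := mul_le_mul_of_nonneg_left hBRb (by positivity)
    linarith only [h1]
  have hNC : KA * ε * (2097152 * ((d : ℝ) + 1) ^ 2 * (εC + aC) ^ 2) + CH * δC =
      (KA * (2097152 * ((d : ℝ) + 1) ^ 2 * (εC + aC) ^ 2)) * ε + CH * δC := by ring
  have hN₂0 : 0 ≤ (KG * (j + C₄ * (ε₄ + a') ^ 2) + KA * Rb) * ε + CG * δW := by positivity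
  have hNC0 : 0 ≤ (KA * (2097152 * ((d : ℝ) + 1) ^ 2 * (εC + aC) ^ 2)) * ε + CH * δC := by positivity
  have hDD : 0 < DC * D₂ := mul_pos hDC hD₂
  -- first summand
  have h1 : 1 / DC * ((KG * ε * (j + C₄ * (ε₄ + a') ^ 2) + 0 * (ε₄ + a') + CG * δW + KA * ε * ‖B‖) / D₂) ≤
      ((KG * (j + C₄ * (ε₄ + a') ^ 2) + KA * Rb) * ε + CG * δW) / (DC * D₂) := by
    rw [one_div, inv_mul_eq_div, div_div, mul_comm D₂ DC]
    exact div_le_div_of_nonneg_right hN₂ hDD.le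
  -- second summand: `DC·D₂ ≤ DC`
  have h2 : (KA * ε * (2097152 * ((d : ℝ) + 1) ^ 2 * (εC + aC) ^ 2) + CH * δC) / DC ≤
      ((KA * (2097152 * ((d : ℝ) + 1) ^ 2 * (εC + aC) ^ 2)) * ε + CH * δC) / (DC * D₂) := by
    rw [hNC]
    exact div_le_div_of_nonneg_left hNC0 hDD (mul_le_of_le_one_right hDC.le hD₂1)
  refine (add_le_add h1 h2).trans ?_
  rw [← add_div, div_mul_eq_mul_div]
  refine div_le_div_of_nonneg_right ?_ hDD.le
  -- the numerator against `Kn·(ε + δ_W + δ_C)`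
  have hc₁ : KG * (j + C₄ * (ε₄ + a') ^ 2) + KA * Rb + KA * (2097152 * ((d : ℝ) + 1) ^ 2 * (εC + aC) ^ 2) ≤ Kn := by
    rw [hKndef]; linarith only [hCG, hCH]
  have hc₂ : CG ≤ Kn := by
    rw [hKndef]
    have : 0 ≤ KG * (j + C₄ * (ε₄ + a') ^ 2) + KA * Rb + KA * (2097152 * ((d : ℝ) + 1) ^ 2 * (εC + aC) ^ 2) := by positivity
    linarith only [this, hCH]
  have hc₃ : CH ≤ Kn := by
    rw [hKndef]
    have : 0 ≤ KG * (j + C₄ * (ε₄ + a') ^ 2) + KA * Rb + KA * (2097152 * ((d : ℝ) + 1) ^ 2 * (εC + aC) ^ 2) := by positivity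
    linarith only [this, hCG]
  linarith only [mul_le_mul_of_nonneg_right hc₁ hε, mul_le_mul_of_nonneg_right hc₂ hδW0, mul_le_mul_of_nonneg_right hc₃ hδC0]


/-- **THE SAME WITH `hRS` DISCHARGED BY THE MODEL LETTERS** (`B9Thm311SmallFieldClosed.hRS_of_unitary`): for UNITARY bond variables
(`(U b)⋆ = (U b)⁻¹`), a tracial `τ` and the compatibility `⟨φ⁻¹X, φ⁻¹Y⟩ = τ(X⋆Y)` the transporters are mutually adjoint, so the species face carries the
background binders {`U(b) ∈ U1`, `‖U(b) − 1‖ ≤ ε`, unitary} ONLY. [folklore] -/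
theorem cur_chart_lipschitz_at_flat_of_small_bonds_unitary {d : ℕ} (L : ℕ) [NeZero L] (m : Fin d → ℕ) [∀ i, NeZero (fineP L m i)] (hL : 1 ≤ L)
    {𝔸 : Type*} [NormedRing 𝔸] [NormedAlgebra ℂ 𝔸] [CompleteSpace 𝔸] [NormOneClass 𝔸] [StarRing 𝔸] [NormedStarGroup 𝔸] [StarModule ℂ 𝔸]
    [FiniteDimensional ℂ 𝔸]
    {W : Type*} [NormedAddCommGroup W] [InnerProductSpace ℂ W] [FiniteDimensional ℂ W] (φ : W ≃ₗ[ℂ] 𝔸) {Mφ Mφ' : ℝ} (hMφ : 0 ≤ Mφ)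
    (hMφ' : 0 ≤ Mφ') (hφ : ∀ w, ‖φ w‖ ≤ Mφ * ‖w‖) (hφ' : ∀ X, ‖φ.symm X‖ ≤ Mφ' * ‖X‖)
    (τ : 𝔸 →ₗ[ℂ] ℂ) {Cτ : ℝ} (hτ : ∀ X, ‖τ X‖ ≤ Cτ * ‖X‖) (hCτ : 0 ≤ Cτ)
    (hτφ : ∀ X Y : 𝔸, inner ℂ (φ.symm X) (φ.symm Y) = τ (star X * Y)) (htr : ∀ X Y : 𝔸, τ (X * Y) = τ (Y * X))
    {η : ℝ} [Fact (0 < (L : ℝ))] [Fact (0 < η)] {lev₀ : Bond d (fineP L m) → ℕ} {levB : Bond d m → ℕ} (lev₁ : Bond d (fineP L m) × Fin d → ℕ)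
    (hlev : ∀ b, 1 ≤ lev₀ b) {c₀ c₁ : ℝ} [Fact (0 < c₀)] [Fact (0 < c₁)] {a : ℝ} (ha : 0 < a) {C₄ a₃ : ℝ} (hC₄ : 0 ≤ C₄) (ha₃ : 0 < a₃) :
    ∃ ε₃ ε₄ εC K r Rb : ℝ, 0 < ε₃ ∧ ε₃ ≤ 1 / (256 * ((d : ℝ) + 1) ^ 2 * (L : ℝ) ^ (d + 1)) ∧ 0 < K ∧ 0 < r ∧ 0 < Rb ∧
      ∀ (U : Bond d (fineP L m) → 𝔸ˣ) (hU : ∀ b, U b ∈ U1 𝔸) {ε : ℝ} (hε : 0 ≤ ε)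
      (hεr : ε ≤ 1 / (256 * ((d : ℝ) + 1) ^ 2 * (L : ℝ) ^ (d + 1))), ε ≤ ε₃ → ∀ (hUε : ∀ b, ‖(U b : 𝔸) - 1‖ ≤ ε),
      (∀ b, star (U b : 𝔸) = (((U b)⁻¹ : 𝔸ˣ) : 𝔸)) →
      ∀ {W₁ : Space115 (L : ℝ) η lev₀ lev₁ (nabla115 η U) → NegSize (L : ℝ) η lev₀ 3 𝔸}
        {W₂ : Space115 (L : ℝ) η lev₀ lev₁ (nabla115 η fun _ : Bond d (fineP L m) => (1 : 𝔸ˣ)) → NegSize (L : ℝ) η lev₀ 3 𝔸},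
        QuadAnalytic W₁ C₄ a₃ → QuadAnalytic W₂ C₄ a₃ →
      ∀ {δW : ℝ}, 0 ≤ δW →
        (∀ P : Space115 (L : ℝ) η lev₀ lev₁ (nabla115 η U), ‖P‖ < r →
          ‖W₁ P - W₂ (LinearMap.toContinuousLinearMap
            ((jetLinearEquiv (L : ℝ) η lev₀ lev₁ (nabla115 η (fun _ : Bond d (fineP L m) => (1 : 𝔸ˣ)))).symm.toLinearMap ∘ₗ
              (jetLinearEquiv (L : ℝ) η lev₀ lev₁ (nabla115 η U)).toLinearMap) P)‖ ≤ δW) →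
      ∀ B ∈ ball (0 : NegSize (L : ℝ) η levB 0 𝔸) Rb,
      ∃ (hpos : ∀ x : BondL2K ℂ d (fineP L m) c₀ W, x ≠ 0 →
          0 < RCLike.re (inner ℂ x (laplaceAofBackground L m hL φ U (alpha_le_64 hL hε hεr) (perCfg_mem_U1 L m hU)
            (hreg_of_small_bonds L m hU hε hUε) τ η (c₀ := c₀) (c₁ := c₁) a x)))
        (hpos₁ : ∀ x : BondL2K ℂ d (fineP L m) c₀ W, x ≠ 0 →
          0 < RCLike.re (inner ℂ x (laplaceAofBackground L m hL φ (fun _ => 1) (show (0 : ℝ) ≤ 1 / 64 by norm_num) (hU1_one L m) (hreg_one L m)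
            τ η (c₀ := c₀) (c₁ := c₁) a x))),
      ‖LinearMap.toContinuousLinearMap
            ((jetLinearEquiv (L : ℝ) η lev₀ lev₁ (nabla115 η (fun _ : Bond d (fineP L m) => (1 : 𝔸ˣ)))).symm.toLinearMap ∘ₗ
              (jetLinearEquiv (L : ℝ) η lev₀ lev₁ (nabla115 η U)).toLinearMap)
          (chartHB (frakGLatticeCLM (lev₀ := lev₀) φ hpos (QtorusW_surjective L m hL U (alpha_le_64 hL hε hεr) (perCfg_mem_U1 L m hU)
              (hreg_of_small_bonds L m hU hε hUε) (alphaL_le_half hL hεr) φ) lev₁ (nabla115 η U)) 0 W₁ 0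
            (fun A' => A' + solA (H1LatticeCLM (lev₀ := lev₀) (levB := levB) φ hpos (QtorusW_surjective L m hL U (alpha_le_64 hL hε hεr)
              (perCfg_mem_U1 L m hU) (hreg_of_small_bonds L m hU hε hUε) (alphaL_le_half hL hεr) φ) lev₁ (nabla115 η U)) 0
              (Cc L m η U lev₀ lev₁ (nabla115 η U) levB) 0 εC A') ε₄
            (H1LatticeCLM (lev₀ := lev₀) (levB := levB) φ hpos (QtorusW_surjective L m hL U (alpha_le_64 hL hε hεr) (perCfg_mem_U1 L m hU)
              (hreg_of_small_bonds L m hU hε hUε) (alphaL_le_half hL hεr) φ) lev₁ (nabla115 η U)) B) -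
        chartHB (frakGLatticeCLM (lev₀ := lev₀) (Δ₁ := hessOp φ η (fun _ => 1) τ)
              (Q := QtorusW L m hL φ (fun _ => 1) (show (0 : ℝ) ≤ 1 / 64 by norm_num) (hU1_one L m) (hreg_one L m) (c₀ := c₀) (c₁ := c₁))
              φ hpos₁ (QtorusW_surjective L m hL (fun _ => 1) (show (0 : ℝ) ≤ 1 / 64 by norm_num) (hU1_one L m) (hreg_one L m)
                (show 50 * ((d : ℝ) + 1) * (0 : ℝ) * (L : ℝ) ^ d ≤ 1 / 2 by norm_num) φ) lev₁ (nabla115 η fun _ => 1)) 0 W₂ 0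
          (fun A' => A' + solA (H1LatticeCLM (lev₀ := lev₀) (levB := levB) (Δ₁ := hessOp φ η (fun _ => 1) τ)
              (Q := QtorusW L m hL φ (fun _ => 1) (show (0 : ℝ) ≤ 1 / 64 by norm_num) (hU1_one L m) (hreg_one L m) (c₀ := c₀) (c₁ := c₁))
              φ hpos₁ (QtorusW_surjective L m hL (fun _ => 1) (show (0 : ℝ) ≤ 1 / 64 by norm_num) (hU1_one L m) (hreg_one L m)
                (show 50 * ((d : ℝ) + 1) * (0 : ℝ) * (L : ℝ) ^ d ≤ 1 / 2 by norm_num) φ) lev₁ (nabla115 η fun _ => 1)) 0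
            (Cc L m η (fun _ : Bond d (fineP L m) => (1 : 𝔸ˣ)) lev₀ lev₁ (nabla115 η fun _ => 1) levB) 0 εC A') ε₄
          (H1LatticeCLM (lev₀ := lev₀) (levB := levB) (Δ₁ := hessOp φ η (fun _ => 1) τ)
            (Q := QtorusW L m hL φ (fun _ => 1) (show (0 : ℝ) ≤ 1 / 64 by norm_num) (hU1_one L m) (hreg_one L m) (c₀ := c₀) (c₁ := c₁))
            φ hpos₁ (QtorusW_surjective L m hL (fun _ => 1) (show (0 : ℝ) ≤ 1 / 64 by norm_num) (hU1_one L m) (hreg_one L m)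
              (show 50 * ((d : ℝ) + 1) * (0 : ℝ) * (L : ℝ) ^ d ≤ 1 / 2 by norm_num) φ) lev₁ (nabla115 η fun _ => 1)) B‖ ≤
        K * (ε + δW) := by
  obtain ⟨ε₃, ε₄, εC, K, r, Rb, hε₃, hle, hK, hr, hRb, H⟩ := cur_chart_lipschitz_at_flat_of_small_bonds L m hL φ hMφ hMφ' hφ hφ' τ hτ hCτ
    (η := η) (levB := levB) lev₁ hlev (c₀ := c₀) (c₁ := c₁) ha hC₄ ha₃
  refine ⟨ε₃, ε₄, εC, K, r, Rb, hε₃, hle, hK, hr, hRb, ?_⟩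
  intro U hU ε hε hεr hεm hUε hUstar W₁ W₂ hW₁ hW₂ δW hδW0 hδW B hB
  exact H U hU hε hεr hεm hUε (hRS_of_unitary φ τ hτφ htr U hUstar) hW₁ hW₂ hδW0 hδW B hB

end Summit.QuantumFields.BalabanUV.T4Continuum.NE9CurChartLipschitzAtFlat

end
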